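import Summits.ResolutionOfSingularities.ResolutionOfSingularities.Theorems.EquisingularLiftEquisingularLiftNatStrictTransformVanishingIdeal
import Summits.ResolutionOfSingularities.ResolutionOfSingularities.Theorems.EquisingularLiftEquisingularLiftNatCarrierStrictTransformStalks
import Summits.ResolutionOfSingularities.ResolutionOfSingularities.Theorems.EquisingularLiftEquisingularLiftNatCarrierDeltaComapFrame
import Literature.AlgebraicGeometry.Resolution.StrictTransformClosedSetPieces
import Literature.AlgebraicGeometry.Resolution.RegularCentreRsopPart
import Literature.AlgebraicGeometry.Resolution.RsopMonomialIdeals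
import Literature.AlgebraicGeometry.Resolution.SymbolicPowersRsop
import Literature.AlgebraicGeometry.Resolution.PermissibleCentres
import Literature.AlgebraicGeometry.Resolution.MarkedIdealsLemmas
import HarnessLib

/-!
# [OURS · L1 W4.5(b) · EL♮(3)] HSUB(ReachTC⁺)₃ brick K7a = T-STCURVE, part 2: the FRAME at a regular point of the running curve and the
# stalk identity `St(𝓢̄ ⊔ K̄) = St(𝓢̄) ⊔ St(K̄)` over it — K7a UNCONDITIONAL: `St_υ(𝓢̄) ⊔ St_υ(K̄) = 𝓘⟨closure υ⁻¹(Z ∖ {y})⟩`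

Crux `EquisingularLiftNat` = stmt-ResolutionOfSingularities-20038 (child EL♮(3) = stmt-ResolutionOfSingularities-20148), route
EquisingularLift, line `sections`; registered stub `stub_elnat_tcPlusPointResolution` (skeleton v11 / child v7), closing on
res-L1-w45b-stub-1's HSUB′(ReachTC⁺)₃ assembly (driver `hsub_reachTCPlus_of_invariant` p526242, brick `inv_step_regular`).
Helper file `--supports stmt-ResolutionOfSingularities-20148 --as helper` by res-D-pv-029 (brick K7a of res-L1-w45b-stub-1's
BRICK DEAL 2026-08-27T11:31:42Z; part 1 = res-L1-w45b-stub-4's …NatStrictTransformVanishingIdeal, p531318). HONEST FRAMING: OURS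
(cell res-hironaka, slot W4.5(b)); NOT a statement of any manuscript; AI-written, weaker than expert review. No `sorry`; standard axioms.

THE OBJECT (stub-1's text): `G` locally Noetherian, `y ∈ G` a closed point with `𝒪_{G,y}` regular; ideal sheaves `𝓢̄`, `K̄` on `G`
with principal stalks at `y` and `𝓢̄ ⊔ K̄ = 𝓘⟨Zc⟩` (`Zc = closure Z`), `y` a REGULAR point of `V(Zc)_red` (the quotient stalk
`𝒪_{G,y}/𝓘⟨Zc⟩_y` is a regular local ring); `υ : G₂ → G` the blow-up of the reduced point `𝓘{y}`. THEN
**`St_υ(𝓢̄) ⊔ St_υ(K̄) = 𝓘⟨closure υ⁻¹(Z ∖ {y})⟩`** (`strictTransformIdeal_sup_eq_vanishingIdeal_of_regularPoint`), in the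
literal currency of the driver's `R`-step (`Z` any set, both sides through `closure`). Part 1 (p531318) proved this MODULO the stalk
identity `hstalk : St(𝓢̄ ⊔ K̄)_{x'} = St(𝓢̄)_{x'} + St(K̄)_{x'}` at the points `x'` over `y`; this file DISCHARGES `hstalk`.

ROUTE.
* `exists_frame_of_regularPair` — LOCAL ALGEBRA: `R` regular local, `h, f ∈ R` with `R/(h, f)` regular and neither `f ∈ (h)`
  nor `h ∈ (f)`; then there is a regular system of parameters `c = (h, f, c₂, …)` of `R` (quasi-regular, `(c) = 𝔪`) whose tail
  `(f, c₂, …)` stays quasi-regular modulo `h` (Matsumura 14.2: the generators `{h, f}` of the regular quotient are selected with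
  independent differentials — `exists_span_eq_of_isRegularLocalRing_quotient` — and both must be selected; extension
  `exists_extend_to_rsop`; tail by res-D-pv-029's `IsQuasiRegular.comp_of_surjective`, Matsumura 16.2). NB: no regularity of
  `V(𝓢̄)` at `y` is needed;
* `stalkIdeal_strictTransformIdeal_sup_eq_of_regularPoint` — `hstalk` VERBATIM: over `y`, if `K̄_y ⊆ 𝓢̄_y` or `𝓢̄_y ⊆ K̄_y` by stalk
  monotonicity of `St`, else the frame above is a CARRIER CONE PACK with the cone `Φ = T₁` of degree one and res-L1-w45b-stub-1's
  `stalkIdeal_strictTransformIdeal_sup_eq_sup` (…NatCarrierStrictTransformStalks, p522194) applies on `supp St(𝓢̄)` (both sides are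
  the unit ideal off it); `strictTransformIdeal_sup_eq_strictTransformIdeal_sup_of_regularPoint` — the ideal-sheaf equality on `G₂`;
* `closure_preimage_closure_diff_singleton` — `closure υ⁻¹(closure Z ∖ {y}) = closure υ⁻¹(Z ∖ {y})` (the blow-up is an open
  immersion off the centre: `IsBlowup.preimage_closure_diff_support_subset`);
* the statement (part 1's `strictTransformIdeal_sup_eq_vanishingIdeal_point` at `closure Z` + the two items above), and its reading
  `…_of_subschemePoint` in the subscheme-point currency of the driver's `R`-step (`y : V(𝓘⟨closure Z⟩)`, `IsRegularLocalRing` of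
  the subscheme stalk; bridge `isRegularLocalRing_quotient_stalkIdeal_of_subschemePoint`).

References: H. Matsumura, *Commutative Ring Theory* (1986), Thms. 14.2, 16.2; U. Görtz, T. Wedhorn, *Algebraic Geometry I* (2020),
(13.19), Prop. 13.96; The Stacks Project, Tags 080C, 080E, 02OS. Tree inputs: p531318 (stub-4), p522194 (stub-1), res-D-pv-029
…NatCarrierDeltaComapFrame (p520689).
-/

set_option linter.dupNamespace false -- mandated namespace `Summit.<Summit>.<Problem>` of this single-conjunct summit

noncomputable section

open CategoryTheory AlgebraicGeometry TopologicalSpace Topology IsLocalRing MvPolynomial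
open Literature.AlgebraicGeometry.Resolution
open AlgebraicGeometry.Scheme.IdealSheafData

namespace Summit.ResolutionOfSingularities.ResolutionOfSingularities.Cruxes.EquisingularLiftNat.Sections

universe u

/-! ## 1. Local algebra: a regular system of parameters through two equations of a regular codimension-two quotient -/

/-- **The frame at a regular point of `V(h, f)`.** `R` a regular local ring, `h, f ∈ R` with `R/(h, f)` a regular local ring,
`f ∉ (h)` and `h ∉ (f)`. Then there is a regular system of parameters `c = (c₀, c₁, c₂, …, c_{r+1})` of `R` with `c₀ = h`,
`c₁ = f`: `(c) = 𝔪`, `c` quasi-regular, and the tail `(c₁, …)` quasi-regular modulo `c₀` — Matsumura 14.2 selects from the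
generators `{h, f}` of `(h, f)` a sub-family with linearly independent differentials generating `(h, f)`; both `h` and `f` must be
selected (else `f ∈ (h)` or `h ∈ (f)`), so `(h, f)` is part of a regular system of parameters; the tail is quasi-regular
modulo the member `c₀` by Matsumura 16.2 (ii) (`(tail) : c₀ = (tail)`, the ideal of the tail being prime and not containing
`c₀`). [cite: Matsumura1987, Thm. 14.2] [cite: Matsumura1987, Thm. 16.2] -/
theorem exists_frame_of_regularPair {R : Type u} [CommRing R] [IsRegularLocalRing R] {h f : R}
    (hreg : IsRegularLocalRing (R ⧸ (Ideal.span {h} ⊔ Ideal.span {f})))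
    (hfh : f ∉ Ideal.span {h}) (hhf : h ∉ Ideal.span {f}) :
    ∃ (r : ℕ) (c : Fin (r + 1 + 1) → R), Ideal.span (Set.range c) = maximalIdeal R ∧ IsQuasiRegular c ∧
      IsQuasiRegular (fun l : Fin (r + 1) => Ideal.Quotient.mk (Ideal.span {c 0}) (c l.succ)) ∧ c 0 = h ∧ c 1 = f := by
  classical
  set P : Ideal R := Ideal.span {h} ⊔ Ideal.span {f} with hP
  haveI := hreg
  -- `P ⊆ 𝔪` (the quotient is a local ring, hence non-trivial)
  have hPtop : P ≠ ⊤ := by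
    intro htop
    have : Subsingleton (R ⧸ P) := Ideal.Quotient.subsingleton_iff.mpr htop
    exact false_of_nontrivial_of_subsingleton (R ⧸ P)
  have hPm : P ≤ maximalIdeal R := IsLocalRing.le_maximalIdeal hPtop
  have hG : Ideal.span ({h, f} : Set R) = P := by rw [hP, Ideal.span_insert]
  obtain ⟨n, g, hgG, hspan, hli⟩ := exists_span_eq_of_isRegularLocalRing_quotient hPm ({h, f} : Set R) hG
  have hgm : ∀ i, g i ∈ maximalIdeal R := fun i => hPm (hG ▸ Ideal.subset_span (hgG i))
  have hhP : h ∈ P := Ideal.mem_sup_left (Ideal.mem_span_singleton_self h)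
  have hfP : f ∈ P := Ideal.mem_sup_right (Ideal.mem_span_singleton_self f)
  -- both `h` and `f` are selected
  have hi₀ : ∃ i₀, g i₀ = h := by
    by_contra hne
    push Not at hne
    have hall : ∀ i, g i = f := fun i => by
      rcases hgG i with h1 | h1
      · exact absurd h1 (hne i)
      · exact h1
    have hle : P ≤ Ideal.span {f} := by
      rw [← hspan, Ideal.span_le]
      rintro _ ⟨i, rfl⟩
      rw [hall i]
      exact Ideal.mem_span_singleton_self f
    exact hhf (hle hhP)
  have hi₁ : ∃ i₁, g i₁ = f := by
    by_contra hne
    push Not at hne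
    have hall : ∀ i, g i = h := fun i => by
      rcases hgG i with h1 | h1
      · exact h1
      · exact absurd h1 (hne i)
    have hle : P ≤ Ideal.span {h} := by
      rw [← hspan, Ideal.span_le]
      rintro _ ⟨i, rfl⟩
      rw [hall i]
      exact Ideal.mem_span_singleton_self h
    exact hfh (hle hfP)
  obtain ⟨i₀, hi₀⟩ := hi₀
  obtain ⟨i₁, hi₁⟩ := hi₁
  have hne : i₀ ≠ i₁ := by
    rintro rfl
    apply hfh
    rw [← hi₁, hi₀]
    exact Ideal.mem_span_singleton_self h
  -- `g` is part of a regular system of parameters, hence so is `(h, f)`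
  have hind := (linearIndependent_toCotangent_iff_forall_mem g hgm).mp hli
  have hzg : IsRsopPart g := ⟨inferInstance, exists_extend_to_rsop g hgm hind⟩
  have hι : Function.Injective (![i₀, i₁] : Fin 2 → Fin n) := by
    intro a b hab
    fin_cases a <;> fin_cases b
    · rfl
    · exact absurd hab (by simpa using hne)
    · exact absurd hab (by simpa using hne.symm)
    · rfl
  have hz : IsRsopPart (![h, f] : Fin 2 → R) := by
    have h1 := hzg.comp ![i₀, i₁] hι
    have h2 : g ∘ ![i₀, i₁] = ![h, f] := by
      ext a
      fin_cases a
      · simpa using hi₀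
      · simpa using hi₁
    rwa [h2] at h1
  obtain ⟨e, x, hd, hx, hxz⟩ := hz.exists_rsop
  -- reindex `Fin (2 + e)` as `Fin (e + 1 + 1)`
  have hq : e + 1 + 1 = 2 + e := by omega
  let σ : Fin (e + 1 + 1) ≃ Fin (2 + e) := finCongr hq
  have hσ0 : σ 0 = Fin.castAdd e 0 := Fin.ext rfl
  have hσ1 : σ 1 = Fin.castAdd e 1 := Fin.ext (by simp [σ])
  have hc0 : (x ∘ σ) 0 = h := by
    rw [Function.comp_apply, hσ0, hxz]; rfl
  have hc1 : (x ∘ σ) 1 = f := by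
    rw [Function.comp_apply, hσ1, hxz]; rfl
  have hzx : IsRsopPart x := isRsopPart_comp_of_rsop hd x hx id Function.injective_id
  refine ⟨e, x ∘ σ, ?_, isQuasiRegular_rsop_comp hd x hx σ σ.injective, ?_, hc0, hc1⟩
  · rw [σ.surjective.range_comp]; exact hx
  · -- the tail modulo `c₀`
    have hinj : Function.Injective (σ ∘ Fin.succ) := σ.injective.comp (Fin.succ_injective _)
    have htail : IsQuasiRegular (x ∘ (σ ∘ Fin.succ)) := isQuasiRegular_rsop_comp hd x hx (σ ∘ Fin.succ) hinj
    have hprime : (Ideal.span (Set.range (x ∘ (σ ∘ Fin.succ)))).IsPrime := (hzx.comp (σ ∘ Fin.succ) hinj).isPrime_span_range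
    have hnot : (x ∘ σ) 0 ∉ Ideal.span (Set.range (x ∘ (σ ∘ Fin.succ))) := by
      have h1 : σ 0 ∉ Set.range (σ ∘ Fin.succ) := by
        rintro ⟨l, hl⟩
        exact Fin.succ_ne_zero l (σ.injective hl)
      have h2 := hzx.not_mem_span_image h1
      rwa [← Set.range_comp] at h2
    have key := IsQuasiRegular.comp_of_surjective htail (a := (x ∘ σ) 0)
      (fun y hy => ((hprime.mem_or_mem hy).resolve_left hnot))
      (Ideal.Quotient.mk (Ideal.span {(x ∘ σ) 0})) Ideal.Quotient.mk_surjective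
      (Ideal.Quotient.eq_zero_iff_mem.mpr (Ideal.mem_span_singleton_self _)) (by rw [Ideal.mk_ker])
    exact key

/-! ## 2. The stalk identity `St(𝓢̄ ⊔ K̄)_{x'} = St(𝓢̄)_{x'} + St(K̄)_{x'}` over a regular point of `V(𝓢̄ ⊔ K̄)` -/

section PointStep

variable {G G₂ : Scheme.{0}} {υ : G₂ ⟶ G}

/-- Stalk-level monotonicity of the strict transform in the transformed ideal sheaf: if `K₁ ⊆ K₂` at `υ x'` then
`St(K₁)_{x'} ⊆ St(K₂)_{x'}`. [folklore] -/
theorem stalkIdeal_strictTransformIdeal_mono_of_le [IsLocallyNoetherian G₂] (J K₁ K₂ : G.IdealSheafData) {x' : G₂}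
    (h : stalkIdeal K₁ (υ x') ≤ stalkIdeal K₂ (υ x')) :
    stalkIdeal (strictTransformIdeal υ J K₁) x' ≤ stalkIdeal (strictTransformIdeal υ J K₂) x' := by
  rw [stalkIdeal_strictTransformIdeal, stalkIdeal_strictTransformIdeal]
  exact iSup_mono fun n => Submodule.colon_mono (Ideal.map_mono h) (Set.Subset.refl _)

/-- **The `hstalk` hypothesis of res-L1-w45b-stub-4's `strictTransformIdeal_sup_eq_vanishingIdeal_point` (p531318), DISCHARGED at a
regular point.** `υ` the blow-up of a closed point `y` with `𝒪_{G,y}` regular, `𝓢̄_y`, `K̄_y` principal and `𝒪_{G,y}/(𝓢̄ ⊔ K̄)_y` a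
regular local ring; then at every `x'` over `y`: `St(𝓢̄ ⊔ K̄)_{x'} = St(𝓢̄)_{x'} + St(K̄)_{x'}`. When `K̄_y ⊆ 𝓢̄_y` or `𝓢̄_y ⊆ K̄_y` both
sides are the strict transform of the larger one (stalk monotonicity); otherwise `exists_frame_of_regularPair` is a carrier cone pack
with the cone `T₁` of degree one for res-L1-w45b-stub-1's `stalkIdeal_strictTransformIdeal_sup_eq_sup` (…NatCarrierStrictTransformStalks,
p522194) at the points of `supp St(𝓢̄)`, and off `supp St(𝓢̄)` both sides are the unit ideal. [cite: StacksProject, Tag 080C]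
[cite: Matsumura1987, Thm. 14.2] [OURS · L1 W4.5b] toward `stub_elnat_tcPlusPointResolution`; NOT a statement of the manuscript. -/
theorem stalkIdeal_strictTransformIdeal_sup_eq_of_regularPoint [IsLocallyNoetherian G] {y : G} (hy : IsClosed ({y} : Set G))
    (hυ : IsBlowup υ (vanishingIdeal ⟨{y}, hy⟩)) (hreg : IsRegularLocalRing (G.presheaf.stalk y))
    (𝓢 K : G.IdealSheafData) (h𝓢 : (stalkIdeal 𝓢 y).IsPrincipal) (hK : (stalkIdeal K y).IsPrincipal)
    (hDreg : IsRegularLocalRing (G.presheaf.stalk y ⧸ stalkIdeal (𝓢 ⊔ K) y)) :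
    ∀ x' : G₂, υ x' = y →
      stalkIdeal (strictTransformIdeal υ (vanishingIdeal ⟨{y}, hy⟩) (𝓢 ⊔ K)) x' =
        stalkIdeal (strictTransformIdeal υ (vanishingIdeal ⟨{y}, hy⟩) 𝓢) x' ⊔
          stalkIdeal (strictTransformIdeal υ (vanishingIdeal ⟨{y}, hy⟩) K) x' := by
  classical
  haveI : IsProper υ := hυ.isProper
  haveI : IsLocallyNoetherian G₂ := LocallyOfFiniteType.isLocallyNoetherian υ
  intro x' hx
  subst hx
  set J : G.IdealSheafData := vanishingIdeal ⟨{υ x'}, hy⟩ with hJ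
  have hxJ : υ x' ∈ (J.support : Set G) := by
    rw [hJ, Scheme.IdealSheafData.coe_support_vanishingIdeal]; exact Set.mem_singleton _
  by_cases hle : stalkIdeal K (υ x') ≤ stalkIdeal 𝓢 (υ x')
  · have h1 := stalkIdeal_strictTransformIdeal_mono_of_le (υ := υ) J K 𝓢 hle
    have h2 : stalkIdeal (strictTransformIdeal υ J (𝓢 ⊔ K)) x' = stalkIdeal (strictTransformIdeal υ J 𝓢) x' :=
      le_antisymm (stalkIdeal_strictTransformIdeal_mono_of_le J _ _ (by rw [stalkIdeal_sup]; exact sup_le le_rfl hle))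
        (stalkIdeal_strictTransformIdeal_mono_of_le J _ _ (by rw [stalkIdeal_sup]; exact le_sup_left))
    rw [h2, sup_eq_left.mpr h1]
  by_cases hle' : stalkIdeal 𝓢 (υ x') ≤ stalkIdeal K (υ x')
  · have h1 := stalkIdeal_strictTransformIdeal_mono_of_le (υ := υ) J 𝓢 K hle'
    have h2 : stalkIdeal (strictTransformIdeal υ J (𝓢 ⊔ K)) x' = stalkIdeal (strictTransformIdeal υ J K) x' :=
      le_antisymm (stalkIdeal_strictTransformIdeal_mono_of_le J _ _ (by rw [stalkIdeal_sup]; exact sup_le hle' le_rfl))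
        (stalkIdeal_strictTransformIdeal_mono_of_le J _ _ (by rw [stalkIdeal_sup]; exact le_sup_right))
    rw [h2, sup_eq_right.mpr h1]
  -- the generic case: `(h, f)` part of a regular system of parameters
  set R := G.presheaf.stalk (υ x') with hR
  haveI := hreg
  obtain ⟨h, hh⟩ := h𝓢
  obtain ⟨f, hf⟩ := hK
  change stalkIdeal 𝓢 (υ x') = Ideal.span {h} at hh
  change stalkIdeal K (υ x') = Ideal.span {f} at hf
  have hfh : f ∉ Ideal.span {h} := fun hmem => hle (by
    rw [hh, hf]; exact (Ideal.span_singleton_le_iff_mem _).mpr hmem)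
  have hhf : h ∉ Ideal.span {f} := fun hmem => hle' (by
    rw [hh, hf]; exact (Ideal.span_singleton_le_iff_mem _).mpr hmem)
  have hsupy : stalkIdeal (𝓢 ⊔ K) (υ x') = Ideal.span {h} ⊔ Ideal.span {f} := by rw [stalkIdeal_sup, hh, hf]
  haveI := hDreg
  have hreg' : IsRegularLocalRing (R ⧸ (Ideal.span {h} ⊔ Ideal.span {f})) :=
    IsRegularLocalRing.of_ringEquiv (Ideal.quotEquivOfEq hsupy)
  obtain ⟨r, c, hc𝔪, hcq, hcb, hc0, hc1⟩ := exists_frame_of_regularPair hreg' hfh hhf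
  by_cases hxS : x' ∈ (strictTransformIdeal υ J 𝓢).support
  · have hcJ : Ideal.span (Set.range c) = stalkIdeal J (υ x') := by
      rw [hc𝔪, hJ, stalkIdeal_vanishingIdeal_singleton]
    haveI : (Ideal.span (Set.range c)).IsMaximal := by rw [hc𝔪]; exact maximalIdeal.isMaximal R
    haveI : Nontrivial (R ⧸ Ideal.span (Set.range c)) :=
      Ideal.Quotient.nontrivial_iff.mpr (Ideal.IsMaximal.ne_top inferInstance)
    have h𝓢' : stalkIdeal 𝓢 (υ x') = Ideal.span {c 0} := by rw [hc0]; exact hh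
    have hΦ : MvPolynomial.map (Ideal.Quotient.mk (Ideal.span (Set.range c))) (X 0 : MvPolynomial (Fin (r + 1)) R) ≠ 0 := by
      rw [MvPolynomial.map_X]; exact MvPolynomial.X_ne_zero _
    have hK' : stalkIdeal K (υ x') = Ideal.span {MvPolynomial.eval (fun l => c l.succ) (X 0 : MvPolynomial (Fin (r + 1)) R)} := by
      rw [MvPolynomial.eval_X, Fin.succ_zero_eq_one, hc1]; exact hf
    exact stalkIdeal_strictTransformIdeal_sup_eq_sup hυ 𝓢 K x' hxJ c hcJ hcq hcb h𝓢' (X 0) (isHomogeneous_X R 0) hΦ hK' hxS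
  · -- off the carrier's strict transform both sides are the unit ideal
    have h1 : stalkIdeal (strictTransformIdeal υ J 𝓢) x' = ⊤ := stalkIdeal_eq_top_of_not_mem_support hxS
    have h2 : stalkIdeal (strictTransformIdeal υ J (𝓢 ⊔ K)) x' = ⊤ := by
      refine top_le_iff.mp ?_
      rw [← h1]
      exact stalkIdeal_strictTransformIdeal_mono_of_le J _ _ (by rw [stalkIdeal_sup]; exact le_sup_left)
    rw [h1, h2, top_sup_eq]

/-- **`St(𝓢̄) ⊔ St(K̄) = St(𝓢̄ ⊔ K̄)` on `G₂`** under the same hypotheses (res-L1-w45b-stub-4's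
`strictTransformIdeal_sup_eq_of_forall_stalkIdeal` with its stalk hypothesis discharged). [cite: StacksProject, Tag 080C]
[OURS · L1 W4.5b] toward `stub_elnat_tcPlusPointResolution`; NOT a statement of the manuscript. -/
theorem strictTransformIdeal_sup_eq_strictTransformIdeal_sup_of_regularPoint [IsLocallyNoetherian G] {y : G}
    (hy : IsClosed ({y} : Set G)) (hυ : IsBlowup υ (vanishingIdeal ⟨{y}, hy⟩)) (hreg : IsRegularLocalRing (G.presheaf.stalk y))
    (𝓢 K : G.IdealSheafData) (h𝓢 : (stalkIdeal 𝓢 y).IsPrincipal) (hK : (stalkIdeal K y).IsPrincipal)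
    (hDreg : IsRegularLocalRing (G.presheaf.stalk y ⧸ stalkIdeal (𝓢 ⊔ K) y)) :
    strictTransformIdeal υ (vanishingIdeal ⟨{y}, hy⟩) (𝓢 ⊔ K) =
      strictTransformIdeal υ (vanishingIdeal ⟨{y}, hy⟩) 𝓢 ⊔ strictTransformIdeal υ (vanishingIdeal ⟨{y}, hy⟩) K := by
  haveI : IsProper υ := hυ.isProper
  haveI : IsLocallyNoetherian G₂ := LocallyOfFiniteType.isLocallyNoetherian υ
  refine strictTransformIdeal_sup_eq_of_forall_stalkIdeal υ _ 𝓢 K fun x' hx' => ?_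
  refine stalkIdeal_strictTransformIdeal_sup_eq_of_regularPoint hy hυ hreg 𝓢 K h𝓢 hK hDreg x' ?_
  have h1 : υ x' ∈ ((vanishingIdeal (⟨{y}, hy⟩ : Closeds G)).support : Set G) := by
    rw [Scheme.IdealSheafData.support_comap] at hx'
    exact hx'
  rw [Scheme.IdealSheafData.coe_support_vanishingIdeal] at h1
  exact h1

/-! ## 3. Topology: closures pass across the point blow-up off the point -/

/-- `closure υ⁻¹(closure Z ∖ {y}) = closure υ⁻¹(Z ∖ {y})` for the blow-up `υ` of the closed point `y` (an open immersion
off `y`). [cite: StacksProject, Tag 02OS] -/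
theorem closure_preimage_closure_diff_singleton {y : G} (hy : IsClosed ({y} : Set G))
    (hυ : IsBlowup υ (vanishingIdeal ⟨{y}, hy⟩)) (Z : Set G) :
    closure (υ ⁻¹' (closure Z \ {y})) = closure (υ ⁻¹' (Z \ {y})) := by
  refine Set.Subset.antisymm (closure_minimal ?_ isClosed_closure)
    (closure_mono (Set.preimage_mono fun z hz => ⟨subset_closure hz.1, hz.2⟩))
  rintro x' ⟨hxZ, hxy⟩
  have h1 : υ x' ∈ closure (Z \ {y}) := by
    have h2 : closure Z \ {y} ⊆ closure (Z \ {y}) := by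
      rw [Set.sdiff_eq, Set.sdiff_eq]
      exact hy.isOpen_compl.closure_inter
    exact h2 ⟨hxZ, hxy⟩
  refine hυ.preimage_closure_diff_support_subset (Z \ {y}) ⟨h1, ?_⟩
  intro hmem
  have h3 : υ x' ∈ (((vanishingIdeal ⟨{y}, hy⟩ : G.IdealSheafData).support : Set G)) := hmem
  rw [Scheme.IdealSheafData.coe_support_vanishingIdeal] at h3
  exact hxy h3

/-! ## 4. K7a = T-STCURVE, unconditional -/

/-- **K7a (T-STCURVE): exactness downstairs after the step at a REGULAR point of the running curve.** `G` locally
Noetherian, `y ∈ G` closed with `𝒪_{G,y}` regular, `υ : G₂ → G` the blow-up of `𝓘{y}`; ideal sheaves `𝓢̄`, `K̄` on `G` with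
principal stalks at `y` and `𝓢̄ ⊔ K̄ = 𝓘⟨closure Z⟩`; `y` a regular point of `V(closure Z)_red` (`𝒪_{G,y}/𝓘⟨closure Z⟩_y`
regular). Then `St_υ(𝓢̄) ⊔ St_υ(K̄) = 𝓘⟨closure υ⁻¹(Z ∖ {y})⟩` — res-L1-w45b-stub-4's `strictTransformIdeal_sup_eq_vanishingIdeal_point`
(p531318) at the closed set `closure Z` with `hstalk` discharged by `stalkIdeal_strictTransformIdeal_sup_eq_of_regularPoint`, and
`closure υ⁻¹(closure Z ∖ {y}) = closure υ⁻¹(Z ∖ {y})`. [cite: Matsumura1987, Thm. 14.2] [cite: GortzWedhorn2020, Prop. 13.96]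
[cite: StacksProject, Tag 080E] [OURS · L1 W4.5b] brick K7a of res-L1-w45b-stub-1's HSUB′(ReachTC⁺)₃ assembly toward
`stub_elnat_tcPlusPointResolution` (stmt-ResolutionOfSingularities-20148 / -20038); NOT a statement of the manuscript. -/
theorem strictTransformIdeal_sup_eq_vanishingIdeal_of_regularPoint [IsLocallyNoetherian G] (υ : G₂ ⟶ G) {y : G}
    (hy : IsClosed ({y} : Set G)) (hυ : IsBlowup υ (vanishingIdeal ⟨{y}, hy⟩))
    (hreg : IsRegularLocalRing (G.presheaf.stalk y)) (𝓢 K : G.IdealSheafData)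
    (h𝓢 : (stalkIdeal 𝓢 y).IsPrincipal) (hK : (stalkIdeal K y).IsPrincipal) (Z : Set G)
    (hD : 𝓢 ⊔ K = vanishingIdeal ⟨closure Z, isClosed_closure⟩)
    (hDreg : IsRegularLocalRing (G.presheaf.stalk y ⧸ stalkIdeal (vanishingIdeal ⟨closure Z, isClosed_closure⟩) y)) :
    strictTransformIdeal υ (vanishingIdeal ⟨{y}, hy⟩) 𝓢 ⊔ strictTransformIdeal υ (vanishingIdeal ⟨{y}, hy⟩) K =
      vanishingIdeal ⟨closure (υ ⁻¹' (Z \ {y})), isClosed_closure⟩ := by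
  haveI : IsProper υ := hυ.isProper
  haveI : IsLocallyNoetherian G₂ := LocallyOfFiniteType.isLocallyNoetherian υ
  rw [← hD] at hDreg
  rw [strictTransformIdeal_sup_eq_vanishingIdeal_point υ hy hυ 𝓢 K (closure Z) isClosed_closure hD
    (stalkIdeal_strictTransformIdeal_sup_eq_of_regularPoint hy hυ hreg 𝓢 K h𝓢 hK hDreg)]
  congr 1
  ext1
  exact closure_preimage_closure_diff_singleton hy hυ Z

/-! ## 5. The same in the subscheme-point currency of the driver's `R`-step -/

/-- The local ring of a closed subscheme `V(I)` at a point is the quotient stalk `𝒪_{X,z}/I_z`; in particular it is a regular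
local ring iff the quotient stalk is. [folklore] -/
theorem isRegularLocalRing_quotient_stalkIdeal_of_subschemePoint {X : Scheme.{u}} (I : X.IdealSheafData) (z : I.subscheme)
    (h : IsRegularLocalRing (I.subscheme.presheaf.stalk z)) :
    IsRegularLocalRing (X.presheaf.stalk (I.subschemeι z) ⧸ stalkIdeal I (I.subschemeι z)) := by
  have hker : stalkIdeal I (I.subschemeι z) = RingHom.ker (I.subschemeι.stalkMap z).hom := by
    have h1 := stalkIdeal_ker_eq_ker_stalkMap I.subschemeι z
    rwa [ker_subschemeι] at h1
  haveI := h
  exact IsRegularLocalRing.of_ringEquiv ((Ideal.quotEquivOfEq hker).trans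
    (RingHom.quotientKerEquivOfSurjective (I.subschemeι.stalkMap_surjective z))).symm

/-- **K7a in the driver's currency**: the point `y` is given as a point of the reduced curve `V(𝓘⟨closure Z⟩)` with regular
local ring there and regular ambient local ring. [cite: Matsumura1987, Thm. 14.2] [OURS · L1 W4.5b] toward
`stub_elnat_tcPlusPointResolution`; NOT a statement of the manuscript. -/
theorem strictTransformIdeal_sup_eq_vanishingIdeal_of_subschemePoint [IsLocallyNoetherian G] (υ : G₂ ⟶ G)
    (𝓢 K : G.IdealSheafData) (Z : Set G) (hD : 𝓢 ⊔ K = vanishingIdeal ⟨closure Z, isClosed_closure⟩)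
    (y : ↥(vanishingIdeal (⟨closure Z, isClosed_closure⟩ : Closeds G)).subscheme)
    (hy : IsClosed ({((vanishingIdeal (⟨closure Z, isClosed_closure⟩ : Closeds G)).subschemeι y : G)} : Set G))
    (hυ : IsBlowup υ (vanishingIdeal ⟨{((vanishingIdeal (⟨closure Z, isClosed_closure⟩ : Closeds G)).subschemeι y : G)}, hy⟩))
    (hyreg : IsRegularLocalRing ((vanishingIdeal (⟨closure Z, isClosed_closure⟩ : Closeds G)).subscheme.presheaf.stalk y))
    (hamb : IsRegularLocalRing (G.presheaf.stalk ((vanishingIdeal (⟨closure Z, isClosed_closure⟩ : Closeds G)).subschemeι y)))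
    (h𝓢 : (stalkIdeal 𝓢 ((vanishingIdeal (⟨closure Z, isClosed_closure⟩ : Closeds G)).subschemeι y)).IsPrincipal)
    (hK : (stalkIdeal K ((vanishingIdeal (⟨closure Z, isClosed_closure⟩ : Closeds G)).subschemeι y)).IsPrincipal) :
    strictTransformIdeal υ (vanishingIdeal ⟨{((vanishingIdeal (⟨closure Z, isClosed_closure⟩ : Closeds G)).subschemeι y : G)}, hy⟩) 𝓢 ⊔
        strictTransformIdeal υ (vanishingIdeal ⟨{((vanishingIdeal (⟨closure Z, isClosed_closure⟩ : Closeds G)).subschemeι y : G)}, hy⟩) K =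
      vanishingIdeal ⟨closure (υ ⁻¹' (Z \ {((vanishingIdeal (⟨closure Z, isClosed_closure⟩ : Closeds G)).subschemeι y : G)})),
        isClosed_closure⟩ :=
  strictTransformIdeal_sup_eq_vanishingIdeal_of_regularPoint υ hy hυ hamb 𝓢 K h𝓢 hK Z hD
    (isRegularLocalRing_quotient_stalkIdeal_of_subschemePoint _ y hyreg)

end PointStep

end Summit.ResolutionOfSingularities.ResolutionOfSingularities.Cruxes.EquisingularLiftNat.Sections

end
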